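import Literature.Analysis.FluidPDE.ScalingUniformRecurrence
import Literature.Dynamics.TopologicalDynamics.UniformRecurrence
import Mathlib.MeasureTheory.Function.LpSpace.Complete
import Mathlib.Topology.Metrizable.Uniformity
import Mathlib.Topology.Sequences
import HarnessLib

/-!
# The `L^p_loc` slab-field space with the Navier–Stokes scaling flow

Topic `Literature/Analysis/FluidPDE` (definition request `defn-ScalingRecurrentSlabField`, for the
crux `RecurrentLiouville` of route NavierStokesRegularity/RecurrentProfiles, whose Theorems files
inline this model space verbatim five times).

**The object.** For a finite-dimensional real inner product space `E` (space), a real normed space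
`F` (values) and an exponent `1 ≤ p`, `SlabField E F p` is the space of space–time fields
`w : ℝ → E → F` (time first) lying in `L^p(Q(0, R))` for every backward parabolic ball
`Q(0, R) = ]-R², 0[ × B(0, R)` about the space–time origin (`parabolicCylinder R 0`), i.e. the
`L^p_loc` fields of the open backward slab `]-∞, 0[ × E` (exhausted by the `Q(0, n+1)`), with the
`L^p_loc` TOPOLOGY: the initial topology of the maps `w ↦ [w] ∈ L^p(Q(0, n+1))`, `n ∈ ℕ`, into the
Banach spaces `Lp F p (volume.restrict Q(0, n+1))`. It is pseudo-metrisable (a countable product of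
metric spaces pulled back), two fields are topologically indistinguishable iff they agree a.e. on
the slab (`inseparable_iff`), and `wⱼ → w` iff `‖wⱼ − w‖_{L^p(Q(0,R))} → 0` for every `R`
(`tendsto_iff_forall`). This is the topology in which Albritton–Barker (2019, Lemma 2.2, §3)
extract limits of rescaled local-energy ancient solutions (`p = 3`, `E = F = ℝ³`).

**The action.** The Navier–Stokes scaling `w ↦ w_λ`, `w_λ(t, x) = λ w(λ² t, λ x)` (`nsRescale`,
Leray 1934 §20), maps `L^p(Q(0, λR))` onto `L^p(Q(0, R))` with the exact factor
`λ (λ^{2+dim E})^{-1/p}` (`eLpNorm_nsRescale_parabolicCylinder`), so the logarithmic scaling flow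
`SlabField.flow σ w = w_{e^σ}` (`= nsScalingFlow σ`) is an action of `(ℝ, +)` on `SlabField E F p`
by continuous maps (`flow_zero`, `flow_add`, `continuous_flow`).

**Orbit closures.** The scaling hull `closure (range fun σ => flow σ w)` is invariant
(`mapsTo_flow_closure_orbit`) and COMPACT as soon as every sequence of orbit points has a convergent
subsequence (`isCompact_closure_orbit`; sequential compactness in a pseudo-metrisable space) — for
Type-I ancient Navier–Stokes solutions that subsequential input is Albritton–Barker's compactness
(their Lemma 2.2), which lives with the equation in the Summits tree; here nothing solves any
equation.

**The dictionary.** For `p = 3`, a slab field `w` is a uniformly recurrent point of the flow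
(`Literature.Dynamics.TopologicalDynamics.IsUniformlyRecurrentPt`, Birkhoff/Furstenberg) iff its
underlying field is uniformly recurrent under scaling in `L³_loc` of the closed lower half-space
(`Literature.Analysis.FluidPDE.IsScalingUniformlyRecurrent`): `isUniformlyRecurrentPt_iff`. Both
directions of the abstract dictionary of `ScalingUniformRecurrence.lean` apply because the
`L³(K)`-balls, `K` compact in `{t ≤ 0} × E`, are neighbourhoods (`K ⊆ Q(0, n+1)` up to the null
hyperplane `{t = 0} × E`, `setOf_eLpNorm_restrict_le_mem_nhds`) and form a neighbourhood base
(`exists_isCompact_setOf_eLpNorm_le_subset`, the balls `Q(0, n+1)` lying in compact boxes). With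
Birkhoff's theorem (`Literature.Dynamics.TopologicalDynamics.exists_isUniformlyRecurrentPt`) this
gives
the standard reduction step `exists_isScalingUniformlyRecurrent_mem_closure_orbit`: a compact
scaling hull contains a field uniformly recurrent under scaling.

## Design notes

* The only instances declared are the canonical topology on the NEW type `SlabField E F p`
  (induced along `toLpPi`) and its pseudo-metrisability; nothing is declared on existing types.
  The exponent is a parameter with `[Fact (1 ≤ p)]` exactly as for Mathlib's `Lp`; users working
  at `p = 3` supply `haveI : Fact (1 ≤ (3 : ℝ≥0∞)) := ⟨by norm_num⟩`.
* Statements are phrased with `eLpNorm (uncurry v.toFun - uncurry w.toFun) p (volume.restrict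
  (parabolicCylinder R 0))`, the form used by the route's Theorems files, so that those files can
  replace their inlined copies by these lemmas. The general-`E` bookkeeping of the balls `Q(0, R)`
  (`ℝ³` versions exist as `SuitableCompactness.mem_parabolicCylinder_zero` etc.) is kept private;
  the public `L^p` scaling laws `eLpNorm_nsRescale_parabolicCylinder`,
  `memLp_nsRescale_parabolicCylinder` generalise the `ℝ³` zoom lemmas of the tree to any `E`, `p`.
* NOT here: joint continuity of `(σ, w) ↦ flow σ w` (continuity of the orbit map needs the
  continuity of dilations in `L^p`, proved for `ℝ³` in the Summits tree), minimality / proximality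
  of hulls, and anything about Navier–Stokes solutions.

## References

* D. Albritton, T. Barker, *Global weak Besov solutions of the Navier–Stokes equations and
  applications*, ARMA 232 (2019) = arXiv:1811.00502, Lemma 2.2, §3. [AlbrittonBarker2019]
* H. Furstenberg, *Recurrence in Ergodic Theory and Combinatorial Number Theory* (1981), Ch. 1 §4,
  Def. 1.8, Thms. 1.15–1.17. [Furstenberg1981]
* J. Leray, Acta Math. 63 (1934), §20 (the scaling). [Leray1934]
-/

noncomputable section

open MeasureTheory Set Function Filter Module Topology TopologicalSpace
open scoped Topology ENNReal NNReal
open Literature.Dynamics.TopologicalDynamics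

namespace Literature.Analysis.FluidPDE

/-! ### Compact closures from subsequential limits (pseudo-metrisable spaces) -/

section SeqCompact

variable {X : Type*} [TopologicalSpace X] [PseudoMetrizableSpace X] {ι : Type*}

/-- **Compactness of a closure from subsequential limits.** In a pseudo-metrisable space, if every
sequence `f (s 0), f (s 1), …` of values of a family `f : ι → X` has a convergent subsequence, then
`closure (range f)` is compact (a sequence in the closure is shadowed by values of `f`; sequential
compactness is compactness in pseudo-metrisable spaces). Used with `f = ` the scaling orbit of a
slab field. [folklore] -/
private theorem isCompact_closure_range_of_forall_seq_subseq (f : ι → X)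
    (h : ∀ s : ℕ → ι, ∃ (a : X) (ψ : ℕ → ℕ), StrictMono ψ ∧
      Tendsto (fun j => f (s (ψ j))) atTop (𝓝 a)) :
    IsCompact (closure (range f)) := by
  letI : PseudoMetricSpace X := TopologicalSpace.pseudoMetrizableSpacePseudoMetric X
  refine IsSeqCompact.isCompact fun x hx => ?_
  have hnear : ∀ k : ℕ, ∃ i : ι, dist (x k) (f i) < 1 / ((k : ℝ) + 1) := by
    intro k
    have hk : (0 : ℝ) < 1 / ((k : ℝ) + 1) := by positivity
    obtain ⟨b, ⟨i, rfl⟩, hd⟩ := Metric.mem_closure_iff.1 (hx k) _ hk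
    exact ⟨i, hd⟩
  choose s hs using hnear
  obtain ⟨a, ψ, hψ, ha⟩ := h s
  refine ⟨a, ?_, ψ, hψ, ?_⟩
  · exact isClosed_closure.mem_of_tendsto ha (Eventually.of_forall fun j => subset_closure ⟨_, rfl⟩)
  · refine ha.congr_dist ?_
    have h1 : Tendsto (fun j => 1 / (((ψ j : ℕ) : ℝ) + 1)) atTop (𝓝 0) :=
      (tendsto_one_div_add_atTop_nhds_zero_nat (𝕜 := ℝ)).comp hψ.tendsto_atTop
    refine squeeze_zero (fun j => dist_nonneg) (fun j => ?_) h1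
    rw [dist_comm]
    exact (hs (ψ j)).le

end SeqCompact

/-! ### The backward parabolic balls about the origin -/

section Balls

variable {E : Type*} [NormedAddCommGroup E]

/-- Membership in `Q(0, R) = ]-R², 0[ × B(0, R)` (general-`E` form of
`SuitableCompactness.mem_parabolicCylinder_zero`). [folklore] -/
private theorem mem_parabolicCylinder_origin {R : ℝ} {z : ℝ × E} :
    z ∈ parabolicCylinder R (0 : ℝ × E) ↔ (-R ^ 2 < z.1 ∧ z.1 < 0) ∧ ‖z.2‖ < R := by
  rw [mem_parabolicCylinder, Prod.fst_zero, Prod.snd_zero, zero_sub, dist_zero_right]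

/-- The balls `Q(0, R)` increase with `R` (for `R ≤ 0` they are empty). [folklore] -/
private theorem parabolicCylinder_origin_mono {R R' : ℝ} (h : R ≤ R') :
    parabolicCylinder R (0 : ℝ × E) ⊆ parabolicCylinder R' (0 : ℝ × E) := by
  intro z hz
  rw [mem_parabolicCylinder_origin] at hz ⊢
  have hR : 0 ≤ R := ((norm_nonneg _).trans_lt hz.2).le
  have h2 : R ^ 2 ≤ R' ^ 2 := pow_le_pow_left₀ hR h 2
  exact ⟨⟨by linarith [hz.1.1], hz.1.2⟩, hz.2.trans_le h⟩

/-- `Q(0, R)` lies in the open backward slab `]-∞, 0[ × E`. [folklore] -/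
private theorem parabolicCylinder_origin_subset_Iio_prod (R : ℝ) :
    parabolicCylinder R (0 : ℝ × E) ⊆ Iio (0 : ℝ) ×ˢ (univ : Set E) := fun _ hz =>
  ⟨(mem_parabolicCylinder_origin.1 hz).1.2, mem_univ _⟩

/-- `Q(0, R)` lies in the box `[-R², 0] × B̄(0, R)` (compact when `E` is finite-dimensional), a
subset of the CLOSED lower half-space `{t ≤ 0} × E`. [folklore] -/
private theorem parabolicCylinder_origin_subset_box (R : ℝ) :
    parabolicCylinder R (0 : ℝ × E) ⊆ Icc (-R ^ 2) 0 ×ˢ Metric.closedBall (0 : E) R := fun _ hz =>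
  ⟨⟨(mem_parabolicCylinder_origin.1 hz).1.1.le, (mem_parabolicCylinder_origin.1 hz).1.2.le⟩,
    mem_closedBall_zero_iff.2 (mem_parabolicCylinder_origin.1 hz).2.le⟩

/-- The open backward slab is exhausted by the balls `Q(0, n + 1)`, `n ∈ ℕ`. [folklore] -/
private theorem Iio_prod_univ_subset_iUnion_parabolicCylinder :
    (Iio (0 : ℝ) ×ˢ (univ : Set E) : Set (ℝ × E)) ⊆
      ⋃ n : ℕ, parabolicCylinder ((n : ℝ) + 1) (0 : ℝ × E) := by
  rintro ⟨s, y⟩ ⟨hs, -⟩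
  obtain ⟨n, hn⟩ := exists_nat_ge (max (-s) ‖y‖)
  have h1 : -s ≤ n := (le_max_left _ _).trans hn
  have h2 : ‖y‖ ≤ n := (le_max_right _ _).trans hn
  have hs' : s < 0 := hs
  refine mem_iUnion.2 ⟨n, mem_parabolicCylinder_origin.2 ⟨⟨?_, hs'⟩, by simp only; linarith⟩⟩
  have h3 : (n : ℝ) + 1 ≤ ((n : ℝ) + 1) ^ 2 := by nlinarith [n.cast_nonneg (α := ℝ)]
  simp only
  linarith

variable [InnerProductSpace ℝ E]

/-- The parabolic dilation `Φ_c (s, y) = (c² s, c y)` (`c > 0`) pulls `Q(0, R)` back to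
`Q(0, R / c)` (general-`E` form of `SuitableCompactness.stAffine_preimage_parabolicCylinder_zero`).
[folklore] -/
private theorem stAffine_sq_preimage_parabolicCylinder_origin {c : ℝ} (hc : 0 < c) (R : ℝ) :
    stAffine (c ^ 2) c 0 (0 : E) ⁻¹' parabolicCylinder R (0 : ℝ × E) =
      parabolicCylinder (R / c) (0 : ℝ × E) := by
  ext ⟨s, y⟩
  have hc2 : 0 < c ^ 2 := by positivity
  have e1 : -(R / c) ^ 2 < s ↔ -R ^ 2 < c ^ 2 * s := by
    rw [div_pow, ← neg_div, div_lt_iff₀ hc2, mul_comm]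
  have e2 : s < 0 ↔ c ^ 2 * s < 0 := by
    constructor
    · intro h
      nlinarith
    · intro h
      nlinarith
  have e3 : ‖y‖ < R / c ↔ c * ‖y‖ < R := by
    rw [lt_div_iff₀ hc, mul_comm]
  simp only [mem_preimage, mem_parabolicCylinder_origin, stAffine_apply, zero_add, norm_smul,
    Real.norm_of_nonneg hc.le]
  rw [e1, e2, e3]

end Balls

/-! ### `L^p(Q(0, R))` under the Navier–Stokes rescaling -/

section Rescale

variable {E : Type*} [NormedAddCommGroup E] [InnerProductSpace ℝ E] [FiniteDimensional ℝ E]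
  [MeasurableSpace E] [BorelSpace E]
variable {F : Type*} [NormedAddCommGroup F] [NormedSpace ℝ F]

omit [FiniteDimensional ℝ E] [MeasurableSpace E] [BorelSpace E] in
/-- The scaling constant `c (c^{2+dim E})^{-1/p}` of `L^p` norms is finite. [folklore] -/
private theorem nsRescaleConst_ne_top (c : ℝ) (p : ℝ≥0∞) :
    ‖c‖ₑ * (ENNReal.ofReal (c ^ 2 * c ^ finrank ℝ E)⁻¹) ^ (1 / p).toReal ≠ ⊤ :=
  ENNReal.mul_ne_top enorm_ne_top
    (ENNReal.rpow_ne_top_of_nonneg ENNReal.toReal_nonneg ENNReal.ofReal_ne_top)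

/-- **Exact scaling law on the backward balls**: for `0 < c`,
`‖w_c‖_{L^p(Q(0, R))} = c (c^{2+dim E})^{-1/p} ‖w‖_{L^p(Q(0, c R))}` (change of variables under
the parabolic dilation, `eLpNorm_nsRescale_restrict_preimage`).
[cite: RobinsonRodrigoSadowskiCUP2016, §10.1 eq. (10.1) and the scaling computation after it; AlbrittonBarker2019, §3 (the rescaled sequence in the proof of Thm. 1.1)] -/
theorem eLpNorm_nsRescale_parabolicCylinder {c : ℝ} (hc : 0 < c) (w : ℝ → E → F) (p : ℝ≥0∞)
    (R : ℝ) :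
    eLpNorm (uncurry (nsRescale c w)) p
        (volume.restrict (parabolicCylinder R (0 : ℝ × E))) =
      ‖c‖ₑ * (ENNReal.ofReal (c ^ 2 * c ^ finrank ℝ E)⁻¹) ^ (1 / p).toReal *
        eLpNorm (uncurry w) p (volume.restrict (parabolicCylinder (c * R) (0 : ℝ × E))) := by
  have h := eLpNorm_nsRescale_restrict_preimage hc w p (parabolicCylinder (c * R) (0 : ℝ × E))
  rwa [stAffine_sq_preimage_parabolicCylinder_origin hc, mul_div_cancel_left₀ R hc.ne'] at h

/-- **Exact scaling law of `L^p` distances on the backward balls**: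
`‖v_c − w_c‖_{L^p(Q(0, R))} = c (c^{2+dim E})^{-1/p} ‖v − w‖_{L^p(Q(0, c R))}`.
[cite: RobinsonRodrigoSadowskiCUP2016, §10.1 eq. (10.1) and the scaling computation after it; AlbrittonBarker2019, §3 (the rescaled sequence in the proof of Thm. 1.1)] -/
theorem eLpNorm_nsRescale_sub_nsRescale_parabolicCylinder {c : ℝ} (hc : 0 < c) (v w : ℝ → E → F)
    (p : ℝ≥0∞) (R : ℝ) :
    eLpNorm (uncurry (nsRescale c v) - uncurry (nsRescale c w)) p
        (volume.restrict (parabolicCylinder R (0 : ℝ × E))) =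
      ‖c‖ₑ * (ENNReal.ofReal (c ^ 2 * c ^ finrank ℝ E)⁻¹) ^ (1 / p).toReal *
        eLpNorm (uncurry v - uncurry w) p
          (volume.restrict (parabolicCylinder (c * R) (0 : ℝ × E))) := by
  have e : uncurry (nsRescale c v) - uncurry (nsRescale c w) = uncurry (nsRescale c (v - w)) := by
    rw [nsRescale_sub]
    rfl
  rw [e, eLpNorm_nsRescale_parabolicCylinder hc]
  rfl

/-- **`L^p` classes under the rescaling**: `w ∈ L^p(Q(0, c R))` gives `w_c ∈ L^p(Q(0, R))`
(`0 < c`). [cite: RobinsonRodrigoSadowskiCUP2016, §10.1 eq. (10.1) and the scaling computation after it; AlbrittonBarker2019, §3 (the rescaled sequence in the proof of Thm. 1.1)] -/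
theorem memLp_nsRescale_parabolicCylinder {c : ℝ} (hc : 0 < c) {w : ℝ → E → F} {p : ℝ≥0∞} {R : ℝ}
    (hw : MemLp (uncurry w) p (volume.restrict (parabolicCylinder (c * R) (0 : ℝ × E)))) :
    MemLp (uncurry (nsRescale c w)) p (volume.restrict (parabolicCylinder R (0 : ℝ × E))) := by
  have hc2 : 0 < c ^ 2 := by positivity
  have hpre : parabolicCylinder R (0 : ℝ × E) =
      stAffine (c ^ 2) c 0 (0 : E) ⁻¹' parabolicCylinder (c * R) (0 : ℝ × E) := by
    rw [stAffine_sq_preimage_parabolicCylinder_origin hc, mul_div_cancel_left₀ R hc.ne']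
  refine ⟨?_, ?_⟩
  · have e : uncurry (nsRescale c w) =
        c • (uncurry w ∘ stAffine (c ^ 2) c 0 (0 : E)) := nsRescale_eq_smul_comp_stAffine c w
    rw [e, hpre]
    refine (hw.1.comp_quasiMeasurePreserving ⟨measurable_stAffine _ _ _ _, ?_⟩).const_smul c
    rw [map_stAffine_volume_restrict_preimage hc2 hc]
    exact Measure.smul_absolutelyContinuous
  · rw [eLpNorm_nsRescale_parabolicCylinder hc]
    exact ENNReal.mul_lt_top (nsRescaleConst_ne_top c p).lt_top hw.2

/-- **`L^p(K) ≤ L^p(Q(0, n+1))` for compact `K ⊆ {t ≤ 0} × E`**: a compact subset of the closed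
lower half-space lies in some `Q(0, n+1)` up to the null hyperplane `{t = 0} × E`, so Lebesgue
measure restricted to `K` is dominated by its restriction to `Q(0, n+1)`. [folklore] -/
private theorem exists_restrict_le_parabolicCylinder {K : Set (ℝ × E)} (hK : IsCompact K)
    (hKH : K ⊆ Iic (0 : ℝ) ×ˢ (univ : Set E)) :
    ∃ n : ℕ, (volume.restrict K : Measure (ℝ × E)) ≤
      volume.restrict (parabolicCylinder ((n : ℝ) + 1) (0 : ℝ × E)) := by
  obtain ⟨R, hR⟩ := hK.isBounded.subset_closedBall (0 : ℝ × E)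
  obtain ⟨n, hn⟩ := exists_nat_ge R
  set Q₀ : Set (ℝ × E) := parabolicCylinder ((n : ℝ) + 1) (0 : ℝ × E) with hQ₀
  set N : Set (ℝ × E) := ({0} : Set ℝ) ×ˢ (univ : Set E) with hN
  have hsub : K ⊆ Q₀ ∪ N := by
    intro z hz
    have hzR : ‖z‖ ≤ R := by simpa [Metric.mem_closedBall, dist_zero_right] using hR hz
    have h1 : |z.1| ≤ R := (norm_fst_le z).trans hzR
    have h2 : ‖z.2‖ ≤ R := (norm_snd_le z).trans hzR
    have hz0 : z.1 ≤ 0 := (hKH hz).1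
    rcases hz0.lt_or_eq with hlt | heq
    · left
      rw [hQ₀, mem_parabolicCylinder_origin]
      refine ⟨⟨?_, hlt⟩, by linarith⟩
      have h3 : -R ≤ z.1 := (abs_le.1 h1).1
      nlinarith [n.cast_nonneg (α := ℝ)]
    · right
      exact ⟨heq, mem_univ _⟩
  have hnull : volume N = 0 := by
    rw [hN, Measure.volume_eq_prod, Measure.prod_prod, Real.volume_singleton, zero_mul]
  have hae : (Q₀ ∪ N : Set (ℝ × E)) =ᵐ[volume] Q₀ := by
    have h := (ae_eq_refl Q₀).union (ae_eq_empty.2 hnull)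
    rwa [union_empty] at h
  refine ⟨n, ?_⟩
  calc volume.restrict K ≤ volume.restrict (Q₀ ∪ N) := Measure.restrict_mono hsub le_rfl
    _ = volume.restrict Q₀ := Measure.restrict_congr_set hae

end Rescale

/-! ### The slab-field space -/

/-- An **`L^p_loc` field on the backward slab** (`SlabField E F p`): a space–time field
`w : ℝ → E → F` (time first) lying in `L^p(Q(0, R))` for every backward parabolic ball
`Q(0, R) = ]-R², 0[ × B(0, R)` about the origin, i.e. in `L^p_loc` of the open backward slab
`]-∞, 0[ × E`; the carrier of the `L^p_loc` topology (`SlabField.instTopologicalSpace`) and of the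
scaling flow (`SlabField.flow`). For `p = 3`, `E = F = ℝ³` this is the space in which
Albritton–Barker take limits of rescaled local-energy ancient solutions.
[cite: AlbrittonBarker2019, Lemma 2.2] -/
@[ext]
structure SlabField (E : Type*) [NormedAddCommGroup E] [InnerProductSpace ℝ E]
    [FiniteDimensional ℝ E] [MeasurableSpace E] [BorelSpace E] (F : Type*) [NormedAddCommGroup F]
    [NormedSpace ℝ F] (p : ℝ≥0∞) where
  /-- The underlying space–time field (time first). -/
  toFun : ℝ → E → F
  /-- The field lies in `L^p` of every backward parabolic ball about the origin. -/
  memLp (R : ℝ) : MemLp (uncurry toFun) p (volume.restrict (parabolicCylinder R (0 : ℝ × E)))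

namespace SlabField

variable {E : Type*} [NormedAddCommGroup E] [InnerProductSpace ℝ E] [FiniteDimensional ℝ E]
  [MeasurableSpace E] [BorelSpace E]
variable {F : Type*} [NormedAddCommGroup F] [NormedSpace ℝ F] {p : ℝ≥0∞}

/-- Constructor testing only the balls of positive radius (`Q(0, R) = ∅` for `R ≤ 0`). [folklore] -/
def ofMemLp (w : ℝ → E → F)
    (hw : ∀ R : ℝ, 0 < R →
      MemLp (uncurry w) p (volume.restrict (parabolicCylinder R (0 : ℝ × E)))) :
    SlabField E F p where
  toFun := w
  memLp R := by
    rcases lt_or_ge 0 R with hR | hR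
    · exact hw R hR
    · have h0 : parabolicCylinder R (0 : ℝ × E) = ∅ := by
        refine eq_empty_of_forall_notMem fun z hz => ?_
        have h := (mem_parabolicCylinder_origin.1 hz).2
        linarith [norm_nonneg z.2]
      rw [h0, Measure.restrict_empty]
      exact ⟨aestronglyMeasurable_zero_measure _, by simp⟩

/-- The embedding into the countable product of the Banach spaces `L^p(Q(0, n+1))`:
`w ↦ ([w] ∈ L^p(Q(0, n+1)))ₙ`. [folklore] -/
def toLpPi (w : SlabField E F p) :
    (n : ℕ) → Lp F p (volume.restrict (parabolicCylinder ((n : ℝ) + 1) (0 : ℝ × E))) :=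
  fun n => (w.memLp ((n : ℝ) + 1)).toLp (uncurry w.toFun)

/-! #### The scaling flow -/

/-- The **scaling flow** on slab fields: `flow σ w = w_{e^σ}`,
`(flow σ w) (t, x) = e^σ • w (e^{2σ} t) (e^σ x)` — the Navier–Stokes scaling in logarithmic
scale (`nsScalingFlow σ`), which preserves `L^p_loc` of the backward slab
(`memLp_nsRescale_parabolicCylinder`). [cite: Leray1934, §20] -/
def flow (σ : ℝ) (w : SlabField E F p) : SlabField E F p where
  toFun := nsRescale (Real.exp σ) w.toFun
  memLp _ := memLp_nsRescale_parabolicCylinder (Real.exp_pos σ) (w.memLp _)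

/-- The field of `flow σ w` is `w_{e^σ} = nsRescale (exp σ) w`. [cite: Leray1934, §20] -/
@[simp]
theorem flow_toFun (σ : ℝ) (w : SlabField E F p) :
    (flow σ w).toFun = nsRescale (Real.exp σ) w.toFun :=
  rfl

/-- The field of `flow σ w` is `nsScalingFlow σ` of the field of `w`. [cite: Leray1934, §20] -/
theorem flow_toFun_eq_nsScalingFlow (σ : ℝ) (w : SlabField E F p) :
    (flow σ w).toFun = nsScalingFlow σ w.toFun :=
  rfl

/-- Orbit points: for `0 < c`, `flow (log c) w` has field `w_c`. [cite: Leray1934, §20] -/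
theorem flow_log_toFun {c : ℝ} (hc : 0 < c) (w : SlabField E F p) :
    (flow (Real.log c) w).toFun = nsRescale c w.toFun := by
  rw [flow_toFun, Real.exp_log hc]

/-- Time `0` of the scaling flow is the identity (`w_1 = w`). [cite: Leray1934, §20] -/
@[simp]
theorem flow_zero (w : SlabField E F p) : flow 0 w = w :=
  SlabField.ext (by rw [flow_toFun, Real.exp_zero, nsRescale_one])

/-- **Action law**: `flow (s + t) = flow s ∘ flow t` (`(w_λ)_μ = w_{λμ}` in logarithmic scale).
[cite: Leray1934, §20] -/
theorem flow_add (s t : ℝ) (w : SlabField E F p) : flow (s + t) w = flow s (flow t w) :=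
  SlabField.ext
    (by simpa only [flow_toFun, nsScalingFlow_apply] using nsScalingFlow_add s t w.toFun)

/-! #### The `L^p_loc` topology -/

variable [Fact (1 ≤ p)]

/-- The **`L^p_loc` topology** on slab fields: the initial topology of the maps
`w ↦ [w] ∈ L^p(Q(0, n+1))`, `n ∈ ℕ`: the Fréchet topology of the increasing sequence of seminorms
`‖·‖_{L^p(Q(0, n+1))}` on the exhaustion `Q(0, n+1) ↑ ]-∞, 0[ × E` (as for Rudin's `C(Ω)`), i.e. the
`L^p_loc` topology of the backward slab in which Albritton–Barker take limits of rescaled solutions.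
[cite: Rudin1991, Thm. 1.37, Rem. 1.38 (c) and §1.44; AlbrittonBarker2019, §2 Lemma 2.2] -/
instance instTopologicalSpace : TopologicalSpace (SlabField E F p) :=
  TopologicalSpace.induced toLpPi inferInstance

/-- `toLpPi` induces the topology. [cite: Rudin1991, Thm. 1.37, Rem. 1.38 (c) and §1.44] -/
theorem isInducing_toLpPi : IsInducing (toLpPi : SlabField E F p → _) :=
  ⟨rfl⟩

/-- `toLpPi` is continuous (each seminorm is continuous).
[cite: Rudin1991, Thm. 1.37, Rem. 1.38 (c) and §1.44] -/
theorem continuous_toLpPi : Continuous (toLpPi : SlabField E F p → _) :=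
  isInducing_toLpPi.continuous

/-- The `L^p_loc` topology is pseudo-metrisable (a countable family of seminorms; hence first
countable and regular). [cite: Rudin1991, Thm. 1.37, Rem. 1.38 (c) and §1.44] -/
instance instPseudoMetrizableSpace : PseudoMetrizableSpace (SlabField E F p) :=
  isInducing_toLpPi.pseudoMetrizableSpace

omit [Fact (1 ≤ p)] in
/-- Distances in the `n`-th factor are the seminorm distances `‖v − w‖_{L^p(Q(0, n+1))}`.
[cite: Rudin1991, Thm. 1.37, Rem. 1.38 (c) and §1.44] -/
theorem edist_toLpPi (v w : SlabField E F p) (n : ℕ) :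
    edist (v.toLpPi n) (w.toLpPi n) = eLpNorm (uncurry v.toFun - uncurry w.toFun) p
      (volume.restrict (parabolicCylinder ((n : ℝ) + 1) (0 : ℝ × E))) :=
  Lp.edist_toLp_toLp _ _ _ _

/-- **Convergence of slab fields** is convergence in every seminorm `L^p(Q(0, n+1))`.
[cite: Rudin1991, Thm. 1.37, Rem. 1.38 (c) and §1.44; AlbrittonBarker2019, §2 Lemma 2.2] -/
theorem tendsto_iff_forall_nat {ι : Type*} {l : Filter ι} (x : ι → SlabField E F p)
    (a : SlabField E F p) :
    Tendsto x l (𝓝 a) ↔ ∀ n : ℕ, Tendsto (fun i => eLpNorm (uncurry (x i).toFun - uncurry a.toFun) p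
      (volume.restrict (parabolicCylinder ((n : ℝ) + 1) (0 : ℝ × E)))) l (𝓝 0) := by
  rw [isInducing_toLpPi.tendsto_nhds_iff, tendsto_pi_nhds]
  refine forall_congr' fun n => ?_
  exact Lp.tendsto_Lp_iff_tendsto_eLpNorm'' (fun i => uncurry (x i).toFun) (fun i => (x i).memLp _)
    (uncurry a.toFun) (a.memLp _)

/-- **Convergence of slab fields** is convergence in every `L^p(Q(0, R))`, `R > 0`.
[cite: Rudin1991, Thm. 1.37, Rem. 1.38 (c) and §1.44; AlbrittonBarker2019, §2 Lemma 2.2] -/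
theorem tendsto_iff_forall {ι : Type*} {l : Filter ι} (x : ι → SlabField E F p)
    (a : SlabField E F p) :
    Tendsto x l (𝓝 a) ↔ ∀ R : ℝ, 0 < R →
      Tendsto (fun i => eLpNorm (uncurry (x i).toFun - uncurry a.toFun) p
        (volume.restrict (parabolicCylinder R (0 : ℝ × E)))) l (𝓝 0) := by
  rw [tendsto_iff_forall_nat]
  refine ⟨fun h R _ => ?_, fun h n => h _ (by positivity)⟩
  exact tendsto_of_tendsto_of_tendsto_of_le_of_le tendsto_const_nhds (h ⌈R⌉₊) (fun _ => zero_le)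
    fun i => eLpNorm_mono_measure _ (Measure.restrict_mono
      (parabolicCylinder_origin_mono ((Nat.le_ceil R).trans (by linarith))) le_rfl)

/-- Convergence of flow points `flow (σ i) w → a` in terms of the rescaled fields
`w_{e^{σ i}}`, on every `Q(0, R)`, `R > 0` (the form in which limits of rescaled solutions are
taken).
[cite: AlbrittonBarker2019, §2 Lemma 2.2 and §3 (proof of Thm. 1.1)] -/
theorem tendsto_flow_iff_forall {ι : Type*} {l : Filter ι} (σ : ι → ℝ) (w a : SlabField E F p) :
    Tendsto (fun i => flow (σ i) w) l (𝓝 a) ↔ ∀ R : ℝ, 0 < R → Tendsto (fun i =>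
      eLpNorm (uncurry (nsRescale (Real.exp (σ i)) w.toFun) - uncurry a.toFun) p
        (volume.restrict (parabolicCylinder R (0 : ℝ × E)))) l (𝓝 0) :=
  tendsto_iff_forall _ _

/-- **Neighbourhood basis**: the `L^p(Q(0, n+1))`-balls `{v | ‖v − w‖_{L^p(Q(0,n+1))} < ε}`,
`n ∈ ℕ`, `ε > 0`, form a basis of neighbourhoods of `w` (the pulled-back factor topologies are
directed, the seminorms being monotone in `n`, so single balls suffice — Rudin's local base `V_n`
for an increasing sequence of seminorms). [cite: Rudin1991, Thm. 1.37, Rem. 1.38 (c) and §1.44] -/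
theorem nhds_hasBasis (w : SlabField E F p) :
    (𝓝 w).HasBasis (fun q : ℕ × ℝ≥0∞ => 0 < q.2) fun q =>
      {v | eLpNorm (uncurry v.toFun - uncurry w.toFun) p
        (volume.restrict (parabolicCylinder ((q.1 : ℝ) + 1) (0 : ℝ × E))) < q.2} := by
  -- the neighbourhood filter is the directed infimum of the pulled-back factor filters
  set G : ℕ → Filter (SlabField E F p) := fun n => comap (fun v => v.toLpPi n) (𝓝 (w.toLpPi n))
  have hnhds : 𝓝 w = ⨅ n, G n := by
    rw [isInducing_toLpPi.nhds_eq_comap w, nhds_pi, Filter.pi, Filter.comap_iInf]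
    refine iInf_congr fun n => ?_
    rw [Filter.comap_comap]
    rfl
  have hmono : ∀ {n m : ℕ}, n ≤ m → ∀ f : ℝ × E → F,
      eLpNorm f p (volume.restrict (parabolicCylinder ((n : ℝ) + 1) (0 : ℝ × E))) ≤
        eLpNorm f p (volume.restrict (parabolicCylinder ((m : ℝ) + 1) (0 : ℝ × E))) := by
    intro n m hnm f
    have hnm' : (n : ℝ) ≤ m := Nat.cast_le.2 hnm
    exact eLpNorm_mono_measure _ (Measure.restrict_mono
      (parabolicCylinder_origin_mono (by linarith)) le_rfl)
  have hanti : ∀ {n m : ℕ}, n ≤ m → G m ≤ G n := by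
    intro n m hnm s hs
    obtain ⟨t, ht, hts⟩ := hs
    obtain ⟨δ, hδ, hδt⟩ := EMetric.mem_nhds_iff.1 ht
    refine ⟨Metric.eball (w.toLpPi m) δ, Metric.eball_mem_nhds _ hδ, fun v hv => hts (hδt ?_)⟩
    have hv' : edist (v.toLpPi m) (w.toLpPi m) < δ := hv
    show edist (v.toLpPi n) (w.toLpPi n) < δ
    rw [edist_toLpPi] at hv' ⊢
    exact (hmono hnm _).trans_lt hv'
  have hdir : Directed (· ≥ ·) G := directed_of_isDirected_le fun _ _ h => hanti h
  refine ⟨fun U => ⟨fun hU => ?_, ?_⟩⟩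
  · rw [hnhds] at hU
    obtain ⟨n, t, ht, htU⟩ := (Filter.mem_iInf_of_directed hdir U).1 hU
    obtain ⟨δ, hδ, hδt⟩ := EMetric.mem_nhds_iff.1 ht
    refine ⟨(n, δ), hδ, fun v hv => htU (hδt ?_)⟩
    show edist (v.toLpPi n) (w.toLpPi n) < δ
    rwa [edist_toLpPi]
  · rintro ⟨⟨n, δ⟩, hδ, hU⟩
    refine mem_of_superset
      (((continuous_apply n).comp continuous_toLpPi).continuousAt.preimage_mem_nhds
        (Metric.eball_mem_nhds _ hδ)) fun v hv => hU ?_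
    have hv' : edist (v.toLpPi n) (w.toLpPi n) < δ := hv
    rwa [edist_toLpPi] at hv'

/-- The `L^p(Q(0, R))`-balls about `w` are neighbourhoods of `w` (any `R`, any `ε > 0`).
[cite: Rudin1991, Thm. 1.37, Rem. 1.38 (c) and §1.44] -/
theorem ball_mem_nhds (w : SlabField E F p) (R : ℝ) {ε : ℝ≥0∞} (hε : 0 < ε) :
    {v : SlabField E F p | eLpNorm (uncurry v.toFun - uncurry w.toFun) p
      (volume.restrict (parabolicCylinder R (0 : ℝ × E))) < ε} ∈ 𝓝 w := by
  refine mem_of_superset ((nhds_hasBasis w).mem_of_mem (i := (⌈R⌉₊, ε)) hε) fun v hv => ?_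
  exact lt_of_le_of_lt (eLpNorm_mono_measure _ (Measure.restrict_mono
    (parabolicCylinder_origin_mono ((Nat.le_ceil R).trans (by linarith))) le_rfl)) hv

/-- The closed `L^p(K)`-balls about `w`, `K` compact in the CLOSED lower half-space `{t ≤ 0} × E`,
are neighbourhoods of `w` — the hypothesis of the dictionary
`IsUniformlyRecurrentPt.isScalingUniformlyRecurrent`. [cite: Rudin1991, Thm. 1.37, Rem. 1.38 (c) and §1.44] -/
theorem setOf_eLpNorm_restrict_le_mem_nhds (w : SlabField E F p) {ε : ℝ} (hε : 0 < ε)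
    {K : Set (ℝ × E)} (hK : IsCompact K) (hKH : K ⊆ Iic (0 : ℝ) ×ˢ (univ : Set E)) :
    {v : SlabField E F p | eLpNorm (fun z : ℝ × E => v.toFun z.1 z.2 - w.toFun z.1 z.2) p
      (volume.restrict K) ≤ ENNReal.ofReal ε} ∈ 𝓝 w := by
  obtain ⟨n, hn⟩ := exists_restrict_le_parabolicCylinder hK hKH
  refine mem_of_superset (ball_mem_nhds w ((n : ℝ) + 1) (ENNReal.ofReal_pos.2 hε)) fun v hv => ?_
  exact ((eLpNorm_mono_measure (uncurry v.toFun - uncurry w.toFun) hn).trans hv.le)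

/-- Every neighbourhood of `w` contains a closed `L^p(K)`-ball about `w` for some compact `K` in
the closed lower half-space and some `ε > 0` (take `K` = the box `[-(n+1)², 0] × B̄(0, n+1)`
around `Q(0, n+1)`) — the hypothesis of the converse dictionary
`IsScalingUniformlyRecurrent.isUniformlyRecurrentPt`. [cite: Rudin1991, Thm. 1.37, Rem. 1.38 (c) and §1.44] -/
theorem exists_isCompact_setOf_eLpNorm_le_subset (w : SlabField E F p) {U : Set (SlabField E F p)}
    (hU : U ∈ 𝓝 w) :
    ∃ ε : ℝ, 0 < ε ∧ ∃ K : Set (ℝ × E), IsCompact K ∧ K ⊆ Iic (0 : ℝ) ×ˢ (univ : Set E) ∧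
      {v : SlabField E F p | eLpNorm (fun z : ℝ × E => v.toFun z.1 z.2 - w.toFun z.1 z.2) p
        (volume.restrict K) ≤ ENNReal.ofReal ε} ⊆ U := by
  obtain ⟨⟨n, δ⟩, hδ, hsub⟩ := (nhds_hasBasis w).mem_iff.1 hU
  obtain ⟨r, -, hr, hrδ⟩ := ENNReal.lt_iff_exists_real_btwn.1 hδ
  refine ⟨r, ENNReal.ofReal_pos.1 hr,
    Icc (-((n : ℝ) + 1) ^ 2) 0 ×ˢ Metric.closedBall (0 : E) ((n : ℝ) + 1),
    isCompact_Icc.prod (isCompact_closedBall _ _),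
    Set.prod_mono Icc_subset_Iic_self (subset_univ _), fun v hv => hsub ?_⟩
  have hv' : eLpNorm (uncurry v.toFun - uncurry w.toFun) p (volume.restrict
      (Icc (-((n : ℝ) + 1) ^ 2) 0 ×ˢ Metric.closedBall (0 : E) ((n : ℝ) + 1))) ≤
      ENNReal.ofReal r := hv
  exact lt_of_le_of_lt ((eLpNorm_mono_measure _ (Measure.restrict_mono
    (parabolicCylinder_origin_subset_box _) le_rfl)).trans hv') hrδ

/-! #### Indistinguishable fields and uniqueness of limits -/

/-- **Limits are unique up to null sets of the slab**: two limits of the same net of slab fields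
agree almost everywhere on the open backward slab `]-∞, 0[ × E` (the seminorms separate exactly
the a.e.-classes of the slab). [cite: Rudin1991, Thm. 1.37 and §1.44] -/
theorem ae_eq_of_tendsto {ι : Type*} {l : Filter ι} [l.NeBot] {x : ι → SlabField E F p}
    {a b : SlabField E F p} (ha : Tendsto x l (𝓝 a)) (hb : Tendsto x l (𝓝 b)) :
    ∀ᵐ z ∂(volume.restrict (Iio (0 : ℝ) ×ˢ (univ : Set E))), a.toFun z.1 z.2 = b.toFun z.1 z.2 := by
  refine ae_restrict_of_ae_restrict_of_subset Iio_prod_univ_subset_iUnion_parabolicCylinder ?_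
  rw [ae_restrict_iUnion_iff]
  intro n
  have ha' := ((continuous_apply n).comp continuous_toLpPi).continuousAt.tendsto.comp ha
  have hb' := ((continuous_apply n).comp continuous_toLpPi).continuousAt.tendsto.comp hb
  have h : a.toLpPi n = b.toLpPi n := tendsto_nhds_unique ha' hb'
  exact (MemLp.toLp_eq_toLp_iff _ _).1 h

/-- **The kernel of the pseudo-metric**: two slab fields are topologically indistinguishable iff
they agree almost everywhere on the open backward slab (the common kernel of the seminorms).
[cite: Rudin1991, Thm. 1.37 and §1.44] -/
theorem inseparable_iff {a b : SlabField E F p} :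
    Inseparable a b ↔ ∀ᵐ z ∂(volume.restrict (Iio (0 : ℝ) ×ˢ (univ : Set E))),
      a.toFun z.1 z.2 = b.toFun z.1 z.2 := by
  constructor
  · intro h
    have hb : Tendsto (fun _ : ℕ => a) atTop (𝓝 b) := by
      rw [← h.nhds_eq]
      exact tendsto_const_nhds
    exact ae_eq_of_tendsto tendsto_const_nhds hb
  · intro h
    have hab : a.toLpPi = b.toLpPi := by
      funext n
      exact (MemLp.toLp_eq_toLp_iff _ _).2 (ae_restrict_of_ae_restrict_of_subset
        (parabolicCylinder_origin_subset_Iio_prod _) h)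
    have h' : Inseparable a.toLpPi b.toLpPi := hab ▸ Inseparable.rfl
    exact isInducing_toLpPi.inseparable_iff.1 h'

/-- **Functionals continuous for one seminorm are continuous**: a functional `Ψ` of fields that is
continuous for the `L^p(Q(0, R))`-seminorm induces a continuous function `w ↦ Ψ w.toFun` on slab
fields (bounded such `Ψ` are the observables whose Cesàro statistics along scaling orbits the
route studies). [cite: Rudin1991, Thm. 1.37 (a)] -/
theorem continuous_comp_toFun {Ψ : (ℝ → E → F) → ℝ} {R : ℝ}
    (hΨ : ∀ v, ∀ ε : ℝ, 0 < ε → ∃ δ : ℝ, 0 < δ ∧ ∀ v',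
      eLpNorm (fun z : ℝ × E => v' z.1 z.2 - v z.1 z.2) p
        (volume.restrict (parabolicCylinder R (0 : ℝ × E))) ≤ ENNReal.ofReal δ → |Ψ v' - Ψ v| ≤ ε) :
    Continuous fun w : SlabField E F p => Ψ w.toFun := by
  refine continuous_iff_continuousAt.2 fun a => ?_
  rw [ContinuousAt, Metric.tendsto_nhds]
  intro ε hε
  obtain ⟨δ, hδ, h⟩ := hΨ a.toFun (ε / 2) (half_pos hε)
  filter_upwards [ball_mem_nhds a R (ENNReal.ofReal_pos.2 hδ)] with w hw
  rw [Real.dist_eq]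
  have h1 := h w.toFun hw.le
  linarith

/-! #### Orbit closures (scaling hulls) -/

/-- Each time-`σ` map of the scaling flow is continuous for the `L^p_loc` topology (exact scaling
law of `L^p` distances: `‖v_c − w_c‖_{L^p(Q(0,n+1))} = const(c) ‖v − w‖_{L^p(Q(0,c(n+1)))}`).
[cite: RobinsonRodrigoSadowskiCUP2016, §10.1 eq. (10.1); Rudin1991, §1.44] -/
theorem continuous_flow (σ : ℝ) : Continuous (flow σ : SlabField E F p → SlabField E F p) := by
  refine continuous_iff_continuousAt.2 fun a => ?_
  rw [ContinuousAt, tendsto_iff_forall]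
  intro R hR
  have hc : 0 < Real.exp σ := Real.exp_pos σ
  have ha := (tendsto_iff_forall (fun v : SlabField E F p => v) a).1 tendsto_id (Real.exp σ * R)
    (by positivity)
  have h := ENNReal.Tendsto.const_mul ha (Or.inr (nsRescaleConst_ne_top (E := E) (Real.exp σ) p))
  rw [mul_zero] at h
  refine h.congr fun v => ?_
  exact (eLpNorm_nsRescale_sub_nsRescale_parabolicCylinder hc v.toFun a.toFun p R).symm

/-- The scaling hull `closure (range fun s => flow s w)` of a slab field is invariant under the
flow (orbit closures are closed invariant sets).
[cite: Furstenberg1981, Ch. 1 §4, Thm. 1.16] -/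
theorem mapsTo_flow_closure_orbit (t : ℝ) (w : SlabField E F p) :
    MapsTo (flow t) (closure (range fun s => flow s w)) (closure (range fun s => flow s w)) :=
  mapsTo_closure_orbit continuous_flow flow_add t w

/-- A slab field lies in its own scaling hull. [cite: Furstenberg1981, Ch. 1 §4, Thm. 1.16] -/
theorem mem_closure_orbit_self (w : SlabField E F p) : w ∈ closure (range fun s => flow s w) :=
  subset_closure ⟨0, flow_zero w⟩

/-- **Compact scaling hulls from subsequential limits**: if every sequence `w_{e^{σ_k}}` of orbit
points of `w` has a subsequence converging in `L^p_loc`, the scaling hull of `w` is compact (for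
Type-I ancient Navier–Stokes solutions the hypothesis is Albritton–Barker's compactness, their
Lemma 2.2). [cite: AlbrittonBarker2019, Lemma 2.2] -/
theorem isCompact_closure_orbit (w : SlabField E F p)
    (h : ∀ σ : ℕ → ℝ, ∃ (a : SlabField E F p) (ψ : ℕ → ℕ), StrictMono ψ ∧
      Tendsto (fun j => flow (σ (ψ j)) w) atTop (𝓝 a)) :
    IsCompact (closure (range fun s => flow s w)) :=
  isCompact_closure_range_of_forall_seq_subseq _ h

/-! #### The dictionary: recurrent points of the flow = fields uniformly recurrent under scaling -/

omit [Fact (1 ≤ p)] in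
/-- **Dictionary** (`p = 3`): a slab field is a uniformly recurrent point of the scaling flow
(Birkhoff/Furstenberg, `IsUniformlyRecurrentPt`) iff its field is uniformly recurrent under scaling
in `L³_loc` of the closed lower half-space (`IsScalingUniformlyRecurrent`): the `L³(K)`-balls, `K`
compact in `{t ≤ 0} × E`, are neighbourhoods and form a neighbourhood base.
[cite: Furstenberg1981, Ch. 1 §4, Def. 1.8] -/
theorem isUniformlyRecurrentPt_iff [Fact (1 ≤ (3 : ℝ≥0∞))] (w : SlabField E F 3) :
    IsUniformlyRecurrentPt (flow (E := E) (F := F) (p := 3)) w ↔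
      IsScalingUniformlyRecurrent w.toFun :=
  ⟨fun h => h.isScalingUniformlyRecurrent (ι := fun v : SlabField E F 3 => v.toFun) (fun _ => rfl)
      (fun _ hε _ hK hKH => w.setOf_eLpNorm_restrict_le_mem_nhds hε hK hKH),
    fun h => h.isUniformlyRecurrentPt (ι := fun v : SlabField E F 3 => v.toFun) (fun _ => rfl)
      (fun _ hU => w.exists_isCompact_setOf_eLpNorm_le_subset hU)⟩

omit [Fact (1 ≤ p)] in
/-- **Birkhoff in the slab-field model**: a compact scaling hull contains a slab field that is
uniformly recurrent under scaling (`exists_isUniformlyRecurrentPt` — every nonempty compact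
invariant set of a flow by continuous maps carries a uniformly recurrent point — read through the
dictionary). The reduction-to-recurrent-profiles step of Liouville arguments for Type-I ancient
solutions. [cite: Furstenberg1981, Ch. 1 §4, Thm. 1.16] -/
theorem exists_isScalingUniformlyRecurrent_mem_closure_orbit [Fact (1 ≤ (3 : ℝ≥0∞))]
    (w : SlabField E F 3) (hS : IsCompact (closure (range fun s => flow s w))) :
    ∃ a ∈ closure (range fun s => flow s w), IsScalingUniformlyRecurrent a.toFun := by
  obtain ⟨a, haS, ha⟩ := exists_isUniformlyRecurrentPt continuous_flow flow_add hS
    ⟨w, mem_closure_orbit_self w⟩ (mapsTo_flow_closure_orbit (w := w))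
  exact ⟨a, haS, (isUniformlyRecurrentPt_iff a).1 ha⟩

end SlabField

end Literature.Analysis.FluidPDE

end
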